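import Literature.NumberTheory.PAdicHodge.BdRPlusLogTypeSeriesAdd
import Literature.NumberTheory.PAdicHodge.BdRPlusLogTypeSeriesTheta
import Literature.NumberTheory.EllipticCurves.FormalGroupFrobeniusTypeProofs
import Literature.NumberTheory.EllipticCurves.FormalLogExpBaseChangeProofs
import Literature.NumberTheory.EllipticCurves.FormalGroupMultiplicationPrimeDecompositionInt
import HarnessLib

/-!
# `log_W(ι x) mod Fil^k B_dR⁺` for `x ∈ Ŵ((p, ξ)𝔸_inf)`: Fontaine's `p`-adic evaluation of the formal logarithm of a Weierstrass curve

Topic `Literature/NumberTheory/PAdicHodge`; namespace `Literature.NumberTheory.PAdicHodge.GaloisContinuity`. Definitions (reviewed):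
`formalLogNum W p` (the `ℤ_p`-numerators `n · coeff_n log_W` of the formal logarithm of an integral Weierstrass equation `W/ℤ`, `p`-integral by
`WeierstrassCurve.norm_natCast_mul_coeff_formalLog_le`) and `IsFormalLogModFil W k x L := IsLogTypeModFil (formalLogNum W p) k x L` («`L ∈ B_dR⁺` is a value of
`log_W(ι x)` modulo `Fil^k`», for `x ∈ (p, ξ)𝔸_inf` a point of `Ŵ`). The INSTANCE `(f, G, b) = (log_W, F_W, formalLogNum W p)` of `BdRPlusLogTypeSeries{,Add,Theta}`:

* `formalLogNum_div_eq` — `b_n/n = coeff_n log_W` in `ℚ_p`; `formalLog_subst_map_formalGroupLaw` — `log_W(F_W(X₀,X₁)) = log_W(X₀) + log_W(X₁)` for the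
  integral law base-changed to `ℚ` (tree `formalLog_subst_formalGroupLaw`, `map_formalGroupLaw`);
* `exists_isFormalLogModFil`, `IsFormalLogModFil.sub_mem_span_xiBdR_pow` (uniqueness), `.galBdRPlus`, `.of_sub_mem`, `.of_approx`;
* ★★ `IsFormalLogModFil.add` — if `g ∈ 𝔸_inf` is the `(p,ξ)`-adic value of `F_W` at `(x, x')` (`g − (F_W)_{≤D}(x,x') ∈ (p,ξ)^{D+1}` for all `D`; this is the
  tree's `AinfTop.addW`, `LubinTate.evalPt`) then **`log_W(ι g) ≡ log_W(ι x) + log_W(ι x') (mod Fil^k)`**;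
* ★ `IsFormalLogModFil.tendsto_thetaBdR` / `.thetaBdR_eq_of_tendsto` — `θ(log_W(ι x) mod Fil^k)` is the classical `p`-adic value `log_W(θ x) ∈ ℂ_F`.

This is the `(p, ξ)`-adic evaluation layer that `AinfWeierstrassKummerIntegral` (K1) explicitly works around: Fontaine's own integrating element
`log_W(ι[ũ])` of the Kummer cocycle of a point `P` of `Ŵ`, with `θ = log_ω(P)` — the quantity of Kato's explicit reciprocity law. Floor (H4) step (3) of
`Summits/…/Cruxes/StarredOptimalManinUnitFiveSeven/Lines/kato-lever-K3-B2-road.md` (memo `…-K3-H4-log.md` §3b; crux K★ `stmt-BirchSwinnertonDyer-22226`).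
Infrastructure only; BSD / K★ are not proved by any of this.

## References
* J. H. Silverman, *The Arithmetic of Elliptic Curves* (2009), IV.5.2, IV.5.5. [SilvermanAEC2009]
* J.-M. Fontaine, *Formes différentielles et modules de Tate…*, Invent. Math. 65 (1982), §5. [Fontaine1982FormesDifferentielles]
* J.-M. Fontaine, *Le corps des périodes p-adiques*, Astérisque 223 (1994), Exp. II §1.5.4. [FontaineAsterisque223III]
-/

noncomputable section

namespace Literature.NumberTheory.PAdicHodge

namespace GaloisContinuity

open ValuativeRel Field Ideal WittVector Finset Filter
open _root_.Topology
open Literature.NumberTheory.GaloisRepresentations Literature.NumberTheory.GaloisRepresentations.IsNonarchimedeanLocalField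
open MvPowerSeries (truncTotal)

variable {F : Type} [Field F] [ValuativeRel F] [TopologicalSpace F] [IsNonarchimedeanLocalField F]
  [CharZero F] {p : ℕ} [Fact p.Prime] [Fact (¬ IsUnit (p : integerC F))]
  [IsAdicComplete (Ideal.span {(p : integerC F)}) (integerC F)]

/-! ## §1 The data `(log_W, F_W, b)` -/

/-- **The `ℤ_p`-numerators `b_n = n · coeff_n(log_W)`** of the formal logarithm of an integral Weierstrass equation (`p`-integral:
`WeierstrassCurve.norm_natCast_mul_coeff_formalLog_le`). [cite: SilvermanAEC2009, IV.5.5] -/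
def formalLogNum (W : WeierstrassCurve ℤ) (p : ℕ) [Fact p.Prime] (n : ℕ) : ℤ_[p] :=
  ⟨(n : ℚ_[p]) * PowerSeries.coeff n (W.map (Int.castRingHom ℚ_[p])).formalLog,
    (W.map (Int.castRingHom ℚ_[p])).norm_natCast_mul_coeff_formalLog_le n⟩

omit [Fact (¬ IsUnit (p : integerC F))] [IsAdicComplete (Ideal.span {(p : integerC F)}) (integerC F)] [CharZero F]
  [ValuativeRel F] [TopologicalSpace F] [IsNonarchimedeanLocalField F] in
/-- `b_n / n = coeff_n(log_W)` in `ℚ_p` (the `ℚ`-series `log_W` of `W/ℚ` base-changed). [cite: SilvermanAEC2009, IV.5.5] -/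
theorem formalLogNum_div_eq (W : WeierstrassCurve ℤ) (n : ℕ) :
    ((formalLogNum W p n : ℤ_[p]) : ℚ_[p]) / (n : ℚ_[p]) =
      algebraMap ℚ ℚ_[p] (PowerSeries.coeff n (W.map (Int.castRingHom ℚ)).formalLog) := by
  have hmap : (W.map (Int.castRingHom ℚ)).map (algebraMap ℚ ℚ_[p]) = W.map (Int.castRingHom ℚ_[p]) := by
    rw [WeierstrassCurve.map_map]; congr 1
  have hcoeff : PowerSeries.coeff n (W.map (Int.castRingHom ℚ_[p])).formalLog =
      algebraMap ℚ ℚ_[p] (PowerSeries.coeff n (W.map (Int.castRingHom ℚ)).formalLog) := by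
    rw [← hmap, ← WeierstrassCurve.map_formalLog, PowerSeries.coeff_map]
  rcases Nat.eq_zero_or_pos n with rfl | hn
  · simp only [Nat.cast_zero, div_zero, PowerSeries.coeff_zero_eq_constantCoeff_apply, WeierstrassCurve.constantCoeff_formalLog, map_zero]
  · have hn0 : (n : ℚ_[p]) ≠ 0 := Nat.cast_ne_zero.2 hn.ne'
    rw [show ((formalLogNum W p n : ℤ_[p]) : ℚ_[p]) = (n : ℚ_[p]) * PowerSeries.coeff n (W.map (Int.castRingHom ℚ_[p])).formalLog from rfl,
      hcoeff, mul_div_cancel_left₀ _ hn0]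

omit [Fact (¬ IsUnit (p : integerC F))] [IsAdicComplete (Ideal.span {(p : integerC F)}) (integerC F)] [CharZero F]
  [ValuativeRel F] [TopologicalSpace F] [IsNonarchimedeanLocalField F] [Fact p.Prime] in
/-- **`log_W(F_W(X₀, X₁)) = log_W(X₀) + log_W(X₁)`** for the INTEGRAL chord–tangent law of `W/ℤ` base-changed to `ℚ`
(tree `formalLog_subst_formalGroupLaw`, `map_formalGroupLaw`). [cite: SilvermanAEC2009, IV.5.2] -/
theorem formalLog_subst_map_formalGroupLaw (W : WeierstrassCurve ℤ) :
    (W.map (Int.castRingHom ℚ)).formalLog.subst (MvPowerSeries.map (Int.castRingHom ℚ) W.formalGroupLaw) =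
      (W.map (Int.castRingHom ℚ)).formalLog.subst (MvPowerSeries.X 0 : MvPowerSeries (Fin 2) ℚ) +
        (W.map (Int.castRingHom ℚ)).formalLog.subst (MvPowerSeries.X 1 : MvPowerSeries (Fin 2) ℚ) := by
  rw [WeierstrassCurve.map_formalGroupLaw]
  exact (W.map (Int.castRingHom ℚ)).formalLog_subst_formalGroupLaw

/-- **`L` is a value of `log_W(ι x)` modulo `Fil^k`** (`x ∈ (p, ξ)𝔸_inf` a point of `Ŵ`): the logarithmic-type series with numerators `formalLogNum W p`.
[cite: Fontaine1982FormesDifferentielles, §5] -/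
def IsFormalLogModFil (W : WeierstrassCurve ℤ) (k : ℕ) (x : Ainf (p := p) F) (L : BDeRhamPlus (integerC F) p) : Prop :=
  IsLogTypeModFil (formalLogNum W p) k x L

/-! ## §2 Existence, uniqueness, equivariance -/

/-- ★ **Existence** of `log_W(ι x) mod Fil^k` for `x ∈ (p, ξ)`. [cite: FontaineAsterisque223III, Exp. II §1.5.4] -/
theorem exists_isFormalLogModFil (W : WeierstrassCurve ℤ) {x : Ainf (p := p) F} (hx : x ∈ Ideal.span {(p : Ainf (p := p) F), xi}) (k : ℕ) :
    ∃ L : BDeRhamPlus (integerC F) p, IsFormalLogModFil W k x L :=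
  exists_isLogTypeModFil _ hx k

/-- **Uniqueness modulo `Fil^k`.** [cite: FontaineAsterisque223III, Exp. II §1.5.3] -/
theorem IsFormalLogModFil.sub_mem_span_xiBdR_pow {W : WeierstrassCurve ℤ} {k : ℕ} {x : Ainf (p := p) F} {L L' : BDeRhamPlus (integerC F) p}
    (hL : IsFormalLogModFil W k x L) (hL' : IsFormalLogModFil W k x L') : L - L' ∈ Ideal.span {(xiBdR : BDeRhamPlus (integerC F) p) ^ k} :=
  IsLogTypeModFil.sub_mem_span_xiBdR_pow hL hL'

omit [CharZero F] in
/-- Invariance modulo `Fil^k`. [cite: FontaineAsterisque223III, Exp. II §1.5.3] -/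
theorem IsFormalLogModFil.of_sub_mem {W : WeierstrassCurve ℤ} {k : ℕ} {x : Ainf (p := p) F} {L L' : BDeRhamPlus (integerC F) p}
    (hL : IsFormalLogModFil W k x L) (h : L' - L ∈ Ideal.span {(xiBdR : BDeRhamPlus (integerC F) p) ^ k}) : IsFormalLogModFil W k x L' :=
  IsLogTypeModFil.of_sub_mem hL h

/-- **`Γ_F`-equivariance**: `σ L` is a value of `log_W(ι σx)`. [cite: FontaineAsterisque223III, Exp. II §1.5.4] -/
theorem IsFormalLogModFil.galBdRPlus {W : WeierstrassCurve ℤ} {k : ℕ} {x : Ainf (p := p) F} {L : BDeRhamPlus (integerC F) p}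
    (hL : IsFormalLogModFil W k x L) (σ : absoluteGaloisGroup F) : IsFormalLogModFil W k (galAinf σ x) (galBdRPlus σ L) :=
  IsLogTypeModFil.galBdRPlus hL σ

/-! ## §3 Additivity along `F_W` and the value under `θ` -/

omit [CharZero F] in
/-- ★★ **`log_W(ι(x ⊕_W x')) ≡ log_W(ι x) + log_W(ι x') (mod Fil^k)`.** For `x, x' ∈ (p, ξ)𝔸_inf`, `g ∈ 𝔸_inf` the `(p, ξ)`-adic value of the integral
chord–tangent law `F_W` at `(x, x')` (`g − (truncTotal_{D+1} F_W)(x, x') ∈ (p,ξ)^{D+1}` for every `D`), and values `L`, `L'` of `log_W(ι x)`,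
`log_W(ι x')` modulo `Fil^k`: `L + L'` is a value of `log_W(ι g)` modulo `Fil^k`. [cite: SilvermanAEC2009, IV.5.2] [cite: Fontaine1982FormesDifferentielles, §5] -/
theorem IsFormalLogModFil.add {W : WeierstrassCurve ℤ} {k : ℕ} {x x' g : Ainf (p := p) F}
    (hx : x ∈ Ideal.span {(p : Ainf (p := p) F), xi}) (hx' : x' ∈ Ideal.span {(p : Ainf (p := p) F), xi})
    (hg : ∀ D : ℕ, g - MvPolynomial.aeval ![x, x'] (truncTotal (D + 1) W.formalGroupLaw) ∈ Ideal.span {(p : Ainf (p := p) F), xi} ^ (D + 1))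
    {L L' : BDeRhamPlus (integerC F) p} (hL : IsFormalLogModFil W k x L) (hL' : IsFormalLogModFil W k x' L') :
    IsFormalLogModFil W k g (L + L') :=
  IsLogTypeModFil.add_of_forall_sub_aeval_truncTotal_mem (formalLogNum_div_eq W) W.constantCoeff_formalGroupLaw
    (formalLog_subst_map_formalGroupLaw W) hx hx' hg hL hL'

/-- ★ **`θ(P_M) → θ(L)`**: the classical partial sums `Σ_{m<M} coeff_{m+1}(log_W) θ(ι x)^{m+1}` converge to `θ(L)` in `ℂ_F` (`k ≥ 1`).
[cite: Fontaine1982FormesDifferentielles, §5] -/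
theorem IsFormalLogModFil.tendsto_thetaBdR {W : WeierstrassCurve ℤ} {k : ℕ} (hk : 1 ≤ k) {x : Ainf (p := p) F} {L : BDeRhamPlus (integerC F) p}
    (hL : IsFormalLogModFil W k x L) : Tendsto (fun M => thetaBdR (logTypePartialSum (formalLogNum W p) x M)) atTop (𝓝 (thetaBdR L)) :=
  IsLogTypeModFil.tendsto_thetaBdR hk hL

/-- ★ **`θ(log_W(ι x) mod Fil^k) = log_W(θ x)`** whenever the classical series `Σ coeff_n(log_W) θ(ι x)ⁿ` converges to `c` in `ℂ_F` (`k ≥ 1`):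
`θ(L) = c`. For Fontaine's integral `x = [ũ]` of a point `P` this is `log_ω(P)`. [cite: Fontaine1982FormesDifferentielles, §5] -/
theorem IsFormalLogModFil.thetaBdR_eq_of_tendsto (hp : valuation F p < 1) {W : WeierstrassCurve ℤ} {k : ℕ} (hk : 1 ≤ k) {x : Ainf (p := p) F}
    {L : BDeRhamPlus (integerC F) p} (hL : IsFormalLogModFil W k x L) {c : CompletedAlgClosure F}
    (hc : Tendsto (fun M => ∑ m ∈ range M,
      algebraMap F (CompletedAlgClosure F) (LocalField.padicRingHom F p hp (PowerSeries.coeff (m + 1) (W.map (Int.castRingHom ℚ_[p])).formalLog)) *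
        thetaBdR (ainfToBdR x) ^ (m + 1)) atTop (𝓝 c)) :
    thetaBdR L = c := by
  refine IsLogTypeModFil.thetaBdR_eq_of_tendsto hp hk hL ?_
  have hb : ∀ m : ℕ, ((formalLogNum W p (m + 1) : ℤ_[p]) : ℚ_[p]) / ((m : ℚ_[p]) + 1) =
      PowerSeries.coeff (m + 1) (W.map (Int.castRingHom ℚ_[p])).formalLog := fun m => by
    have hm0 : ((m : ℚ_[p]) + 1) ≠ 0 := by exact_mod_cast Nat.succ_ne_zero m
    rw [show ((formalLogNum W p (m + 1) : ℤ_[p]) : ℚ_[p]) =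
      ((m + 1 : ℕ) : ℚ_[p]) * PowerSeries.coeff (m + 1) (W.map (Int.castRingHom ℚ_[p])).formalLog from rfl, Nat.cast_succ,
      mul_div_cancel_left₀ _ hm0]
  simp only [hb]
  exact hc

end GaloisContinuity

end Literature.NumberTheory.PAdicHodge

end
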